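import Summits.CriticalPhenomena.PercolationContinuityZ3.Theorems.Transplant.CayleySkeletonScaled
import HarnessLib

/-!
# `CayleyScaled` (II) — (κ′) the cylinders of the re-based chart are connected from some width on; the one-type SCALED skeleton of `Cay(Γ; S)`
# for EVERY finite generating set; `θ(p_c) = 0` modulo the scaled node (and Φ2)

builds on p205010 (kernel theorem, internal audit signed; external expert review pending) — nothing in this file uses p205010.  The percolation
conclusions are CONDITIONAL on the OPEN node `SamePDropOfSkeletonFrmScaled₁` (file `PlanarSkeletonFrmScaledDefs`; hypothesis `hN`, nothing claimed
about it) and on Φ2 at `p_c` (hypothesis `hC`; discharged for quasi-one-dimensional kernels in the sequel `CayleyScaledQuasiLine`).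
Lane `prim-bschramm`, seat `prim-bschramm-p4` gen 16 (PART C3 of `P4-GENERAL.md` §38: ARBITRARY GENERATING SETS).  Helper file
(`--supports stmt-CriticalPhenomena-4575 --as helper`).  Prequel: `CayleySkeletonScaled` (datum, chart `ψ`, steps, connectedness).

* §1 (κ′) **cylinders `{‖ψ‖_∞ ≤ ℓ}` are connected for `ℓ ≥ ℓ₀ := R₁ + N + R_K`**: reduce any vertex to the block `[0, N)²` by single `t₀^{±1}`,
  `t₁^{±1}` edges inside the cylinder (`reduce_coord`), join `1` to a representative of each of the `≤ N²` reduced chart values by a fixed walk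
  (radius `R₁`), and absorb the kernel element that remains by concatenated translates of fixed walks to the kernel generators (radius `R_K`,
  closure induction `ker_walk`).
* §2 **`CayleyScaled.skeletonFrmScaled : PlanarSkeletonFrmScaled (Cay(Γ;S))`** (one type `{1}`, frames = left translations, `L = N`, degree `2|S|`)
  and the conditional theorems **`theta_eq_zero_of_le_of_frmScaledNode₁ : SamePDropOfSkeletonFrmScaled₁ → Φ2(p_c) → ∀ g, ∀ p ≤ p_c, θ_g(p) = 0`**,
  `criticalContinuity_of_frmScaledNode₁`.
[cite: BenjaminiSchramm1996, Conj. 4; §2 (Cayley graphs)] [cite: KozmaNitzan2024, §1 p. 2 (approach 1); §4 pp. 15–16 (boxes, Lemma 8)]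
-/

noncomputable section

namespace Summit.CriticalPhenomena.PercolationContinuityZ3.Theorems.Transplant

open SimpleGraph Walk Subgroup Literature.Probability.LatticeModels Literature.Probability.Percolation
open Literature.Barriers.CriticalPhenomena (countable_of_connected_of_locallyFinite)
open scoped Classical

namespace CayleyScaled

variable {Γ : Type} [Group Γ] {S : Finset Γ} (C : CayleyScaled Γ S)

/-! ## §1 (κ′): cylinders are connected from some width on -/

/-- A chosen walk from `1` to each vertex. [folklore] -/
def W (g : Γ) : (mulCayley (S : Set Γ)).Walk 1 g := (C.reachable_one g).some

/-- **The chart radius of the chosen walk to `g`.** [folklore] -/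
def dev (g : Γ) : ℕ := (C.W g).support.toFinset.sup fun z => max (C.ψ z 0).natAbs (C.ψ z 1).natAbs

/-- The chosen walk to `g` stays in the cylinder of radius `dev g`. [folklore] -/
theorem W_inBox (g : Γ) : ∀ z ∈ (C.W g).support, C.ψ z ∈ box 2 (C.dev g) := by
  intro z hz
  have hle : max (C.ψ z 0).natAbs (C.ψ z 1).natAbs ≤ C.dev g :=
    Finset.le_sup (f := fun z => max (C.ψ z 0).natAbs (C.ψ z 1).natAbs) (List.mem_toFinset.2 hz)
  have h0 : (C.ψ z 0).natAbs ≤ C.dev g := le_trans (le_max_left _ _) hle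
  have h1 : (C.ψ z 1).natAbs ≤ C.dev g := le_trans (le_max_right _ _) hle
  rw [mem_box]
  intro i
  fin_cases i
  · show -(C.dev g : ℤ) ≤ C.ψ z 0 ∧ C.ψ z 0 ≤ C.dev g; omega
  · show -(C.dev g : ℤ) ≤ C.ψ z 1 ∧ C.ψ z 1 ≤ C.dev g; omega

/-- **The kernel radius**: the kernel generators are joined to `1` inside `‖ψ‖_∞ ≤ R_K`. [folklore] -/
def RK : ℕ := C.K.sup C.dev

/-- **Kernel walks** (closure induction): every `k ∈ ker φ` is joined to `1` by a walk inside `‖ψ‖_∞ ≤ R_K` (concatenated left translates of the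
chosen walks to the kernel generators and their reverses). [folklore] -/
theorem ker_walk {k : Γ} (hk : C.φ k = 0) :
    ∃ w : (mulCayley (S : Set Γ)).Walk 1 k, ∀ z ∈ w.support, C.ψ z ∈ box 2 C.RK := by
  have hmem := C.K_gen k hk
  clear hk
  -- strengthen: carry `φ = 0` through the induction
  suffices H : C.φ k = 0 ∧ ∃ w : (mulCayley (S : Set Γ)).Walk 1 k, ∀ z ∈ w.support, C.ψ z ∈ box 2 C.RK from H.2
  have tr : ∀ {x a b : Γ}, C.φ x = 0 → ∀ {w : (mulCayley (S : Set Γ)).Walk a b}, (∀ z ∈ w.support, C.ψ z ∈ box 2 C.RK) →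
      ∀ z ∈ (CayCyl.lmul S x w).support, C.ψ z ∈ box 2 C.RK := by
    intro x a b hx w hw z hz
    obtain ⟨z', hz', rfl⟩ := CayCyl.mem_support_lmul.1 hz
    rw [ψ_mul, (C.ψ_eq_zero_iff x).2 hx, zero_add]; exact hw z' hz'
  induction hmem using Subgroup.closure_induction with
  | mem x hx =>
    refine ⟨C.K_ker x (Finset.mem_coe.1 hx), C.W x, fun z hz => box_mono 2 ?_ (C.W_inBox x z hz)⟩
    exact Finset.le_sup (f := C.dev) (Finset.mem_coe.1 hx)
  | one =>
    refine ⟨C.φ_one, Walk.nil, fun z hz => ?_⟩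
    rw [support_nil, List.mem_singleton] at hz
    subst hz; rw [ψ_one]; exact zero_mem_box 2 _
  | mul x y _ _ hx hy =>
    obtain ⟨hx0, wx, hwx⟩ := hx
    obtain ⟨hy0, wy, hwy⟩ := hy
    refine ⟨by rw [C.map_mul, hx0, hy0, add_zero], wx.append ((CayCyl.lmul S x wy).copy (mul_one x) rfl), fun z hz => ?_⟩
    rw [support_append, List.mem_append] at hz
    rcases hz with hz | hz
    · exact hwx z hz
    · have hz' : z ∈ (CayCyl.lmul S x wy).support := by rw [support_copy] at hz; exact List.tail_subset _ hz
      exact tr hx0 hwy z hz'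
  | inv x _ hx =>
    obtain ⟨hx0, wx, hwx⟩ := hx
    have hx0' : C.φ x⁻¹ = 0 := by rw [C.φ_inv, hx0, neg_zero]
    refine ⟨hx0', (CayCyl.lmul S x⁻¹ wx.reverse).copy (inv_mul_cancel x) (mul_one x⁻¹), fun z hz => ?_⟩
    rw [support_copy] at hz
    exact tr hx0' (fun z hz => hwx z ((CayCyl.mem_support_reverse_iff wx z).1 hz)) z hz

/-- A reduced chart value as a vector. [folklore] -/
def vec (a b : ℕ) : Site 2 := fun i => if i = 0 then (a : ℤ) else (b : ℤ)

/-- **The representatives' radius**: every reduced chart value (in `[0, N)²`) that occurs has a representative joined to `1` inside `‖ψ‖_∞ ≤ R₁`.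
[folklore] -/
def R1 : ℕ := ((Finset.range C.N) ×ˢ (Finset.range C.N)).sup fun ab =>
  if h : ∃ g : Γ, C.ψ g = vec ab.1 ab.2 then C.dev (Classical.choose h) else 0

/-- **The width floor `ℓ₀ = R₁ + N + R_K`.** [folklore] -/
def ℓ₀ : ℕ := C.R1 + C.N + C.RK

/-- **A reduced vertex (`ψ ∈ [0, N)²`) is joined to `1` inside `‖ψ‖_∞ ≤ ℓ₀`**: walk to the representative of its chart value, then a left
translate of a kernel walk. [folklore] -/
theorem exists_walk_of_reduced {g : Γ} (hg : ∀ i : Fin 2, 0 ≤ C.ψ g i ∧ C.ψ g i < C.N) :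
    ∃ w : (mulCayley (S : Set Γ)).Walk 1 g, ∀ z ∈ w.support, C.ψ z ∈ box 2 C.ℓ₀ := by
  set a : ℕ := (C.ψ g 0).toNat with ha
  set b : ℕ := (C.ψ g 1).toNat with hb
  have h0 := hg 0
  have h1 := hg 1
  have hψg : C.ψ g = vec a b := by
    funext i; fin_cases i
    · show C.ψ g 0 = ((C.ψ g 0).toNat : ℤ); rw [Int.toNat_of_nonneg h0.1]
    · show C.ψ g 1 = ((C.ψ g 1).toNat : ℤ); rw [Int.toNat_of_nonneg h1.1]
  have hex : ∃ g' : Γ, C.ψ g' = vec a b := ⟨g, hψg⟩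
  set r : Γ := Classical.choose hex with hr
  have hψr : C.ψ r = vec a b := Classical.choose_spec hex
  have hab : (a, b) ∈ (Finset.range C.N) ×ˢ (Finset.range C.N) := by
    rw [Finset.mem_product, Finset.mem_range, Finset.mem_range]
    constructor
    · have : (a : ℤ) < C.N := by rw [ha, Int.toNat_of_nonneg h0.1]; exact h0.2
      exact_mod_cast this
    · have : (b : ℤ) < C.N := by rw [hb, Int.toNat_of_nonneg h1.1]; exact h1.2
      exact_mod_cast this
  have hdev : C.dev r ≤ C.R1 := by
    have h := Finset.le_sup (f := fun ab : ℕ × ℕ => if h : ∃ g : Γ, C.ψ g = vec ab.1 ab.2 then C.dev (Classical.choose h) else 0) hab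
    simp only [dif_pos hex] at h
    exact h
  -- the kernel element `k = r⁻¹ g`
  have hk : C.φ (r⁻¹ * g) = 0 := by
    rw [← ψ_eq_zero_iff, ψ_mul, ψ_inv, hψr, hψg, neg_add_cancel]
  obtain ⟨wk, hwk⟩ := C.ker_walk hk
  have hψr_abs : ∀ i : Fin 2, |C.ψ r i| ≤ C.N := by
    intro i; rw [hψr, ← hψg]; have := hg i; rw [abs_le]; constructor <;> omega
  refine ⟨(C.W r).append ((CayCyl.lmul S r wk).copy (mul_one r) (mul_inv_cancel_left r g)), fun z hz => ?_⟩
  rw [support_append, List.mem_append] at hz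
  rcases hz with hz | hz
  · exact box_mono 2 (by unfold ℓ₀; omega) ((box_mono 2 hdev) (C.W_inBox r z hz))
  · have hz' : z ∈ (CayCyl.lmul S r wk).support := by rw [support_copy] at hz; exact List.tail_subset _ hz
    obtain ⟨z₀, hz₀, rfl⟩ := CayCyl.mem_support_lmul.1 hz'
    have hb0 := hwk z₀ hz₀
    rw [mem_box] at hb0 ⊢
    intro i
    rw [ψ_mul, Pi.add_apply]
    have h1 := hb0 i
    have h2 := hψr_abs i
    rw [abs_le] at h2
    unfold ℓ₀; push_cast
    constructor <;> omega

/-- **A reduced vertex is reachable from `1` INSIDE the cylinder of every width `ℓ ≥ ℓ₀`.** [folklore] -/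
theorem reachC_of_reduced {ℓ : ℕ} (hℓ : C.ℓ₀ ≤ ℓ) {g : Γ} (hg : ∀ i : Fin 2, 0 ≤ C.ψ g i ∧ C.ψ g i < C.N)
    (h1 : (1 : Γ) ∈ {w | C.ψ w - C.ψ 1 ∈ box 2 ℓ}) (hgm : g ∈ {w | C.ψ w - C.ψ 1 ∈ box 2 ℓ}) :
    ((mulCayley (S : Set Γ)).induce {w | C.ψ w - C.ψ 1 ∈ box 2 ℓ}).Reachable ⟨1, h1⟩ ⟨g, hgm⟩ := by
  obtain ⟨w, hw⟩ := C.exists_walk_of_reduced hg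
  have hw' : ∀ z ∈ w.support, z ∈ {w | C.ψ w - C.ψ 1 ∈ box 2 ℓ} := fun z hz => by
    show C.ψ z - C.ψ 1 ∈ box 2 ℓ; rw [ψ_one, sub_zero]; exact box_mono 2 hℓ (hw z hz)
  exact ⟨w.induce _ hw'⟩

/-- The deviation of a chart coordinate from the block `[0, N)` (a termination measure for the reduction). [folklore] -/
def excess (x : ℤ) : ℕ := (-x).toNat + (x - C.N + 1).toNat

/-- **Reduction of ONE coordinate inside the cylinder**: from any vertex of the cylinder `‖ψ‖_∞ ≤ ℓ` (`ℓ ≥ N`), single `tᵢ^{±1}`-edges lead, inside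
the cylinder, to a vertex whose `i`-th chart coordinate lies in `[0, N)` and whose other coordinate is unchanged. [folklore] -/
theorem reduce_coord (i : Fin 2) {ℓ : ℕ} (hℓ : C.N ≤ ℓ) :
    ∀ (n : ℕ) (g : Γ) (hgm : g ∈ {w | C.ψ w - C.ψ 1 ∈ box 2 ℓ}), C.excess (C.ψ g i) ≤ n →
      ∃ (g' : Γ) (hg'm : g' ∈ {w | C.ψ w - C.ψ 1 ∈ box 2 ℓ}), (0 ≤ C.ψ g' i ∧ C.ψ g' i < C.N) ∧ (∀ j, j ≠ i → C.ψ g' j = C.ψ g j) ∧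
        ((mulCayley (S : Set Γ)).induce {w | C.ψ w - C.ψ 1 ∈ box 2 ℓ}).Reachable ⟨g, hgm⟩ ⟨g', hg'm⟩ := by
  intro n
  induction n with
  | zero =>
    intro g hgm hex
    refine ⟨g, hgm, ?_, fun j _ => rfl, Reachable.refl _⟩
    unfold excess at hex
    constructor <;> omega
  | succ n ih =>
    intro g hgm hex
    by_cases hin : 0 ≤ C.ψ g i ∧ C.ψ g i < C.N
    · exact ⟨g, hgm, hin, fun j _ => rfl, Reachable.refl _⟩
    · have hgbox : C.ψ g ∈ box 2 ℓ := by have := hgm; simp only [Set.mem_setOf_eq, ψ_one, sub_zero] at this; exact this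
      rw [mem_box] at hgbox
      -- one step: forward if the coordinate is negative, backward if it is `≥ N`
      by_cases hneg : C.ψ g i < 0
      · set g₁ := g * C.gen' i with hg₁
        have hψ₁ : C.ψ g₁ = C.ψ g + Pi.single i (C.N : ℤ) := C.ψ_mul_gen' g i
        have hψ₁i : C.ψ g₁ i = C.ψ g i + C.N := by rw [hψ₁, Pi.add_apply, Pi.single_eq_same]
        have hψ₁j : ∀ j, j ≠ i → C.ψ g₁ j = C.ψ g j := fun j hj => by rw [hψ₁, Pi.add_apply, Pi.single_eq_of_ne hj, add_zero]
        have hg₁m : g₁ ∈ {w | C.ψ w - C.ψ 1 ∈ box 2 ℓ} := by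
          show C.ψ g₁ - C.ψ 1 ∈ box 2 ℓ
          rw [ψ_one, sub_zero, mem_box]
          intro j
          by_cases hj : j = i
          · subst hj; rw [hψ₁i]; have := hgbox j; constructor <;> omega
          · rw [hψ₁j j hj]; exact hgbox j
        have hex₁ : C.excess (C.ψ g₁ i) ≤ n := by
          have hN1 := C.one_le_N
          rw [hψ₁i]; unfold excess at hex ⊢; omega
        obtain ⟨g', hg'm, hg'in, hg'j, hreach⟩ := ih g₁ hg₁m hex₁
        refine ⟨g', hg'm, hg'in, fun j hj => by rw [hg'j j hj, hψ₁j j hj], ?_⟩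
        have hadj : ((mulCayley (S : Set Γ)).induce {w | C.ψ w - C.ψ 1 ∈ box 2 ℓ}).Adj ⟨g, hgm⟩ ⟨g₁, hg₁m⟩ :=
          induce_adj.2 (C.adj_gen' i g)
        exact hadj.reachable.trans hreach
      · have hge : (C.N : ℤ) ≤ C.ψ g i := by
          push Not at hneg
          by_contra hlt; push Not at hlt; exact hin ⟨hneg, hlt⟩
        set g₁ := g * (C.gen' i)⁻¹ with hg₁
        have hψ₁ : C.ψ g₁ = C.ψ g - Pi.single i (C.N : ℤ) := C.ψ_mul_gen'_inv g i
        have hψ₁i : C.ψ g₁ i = C.ψ g i - C.N := by rw [hψ₁, Pi.sub_apply, Pi.single_eq_same]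
        have hψ₁j : ∀ j, j ≠ i → C.ψ g₁ j = C.ψ g j := fun j hj => by rw [hψ₁, Pi.sub_apply, Pi.single_eq_of_ne hj, sub_zero]
        have hg₁m : g₁ ∈ {w | C.ψ w - C.ψ 1 ∈ box 2 ℓ} := by
          show C.ψ g₁ - C.ψ 1 ∈ box 2 ℓ
          rw [ψ_one, sub_zero, mem_box]
          intro j
          by_cases hj : j = i
          · subst hj; rw [hψ₁i]; have := hgbox j; constructor <;> omega
          · rw [hψ₁j j hj]; exact hgbox j
        have hex₁ : C.excess (C.ψ g₁ i) ≤ n := by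
          have hN1 := C.one_le_N
          rw [hψ₁i]; unfold excess at hex ⊢; omega
        obtain ⟨g', hg'm, hg'in, hg'j, hreach⟩ := ih g₁ hg₁m hex₁
        refine ⟨g', hg'm, hg'in, fun j hj => by rw [hg'j j hj, hψ₁j j hj], ?_⟩
        have hadj : ((mulCayley (S : Set Γ)).induce {w | C.ψ w - C.ψ 1 ∈ box 2 ℓ}).Adj ⟨g, hgm⟩ ⟨g₁, hg₁m⟩ :=
          induce_adj.2 (C.adj_gen'_inv i g)
        exact hadj.reachable.trans hreach

/-- **(κ′) THE CYLINDERS `{‖ψ‖_∞ ≤ ℓ}`, `ℓ ≥ ℓ₀`, ARE CONNECTED.** [cite: KozmaNitzan2024, §4 p. 15 (boxes)] -/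
theorem cyl_connected_of_le {ℓ : ℕ} (hℓ : C.ℓ₀ ≤ ℓ) : ((mulCayley (S : Set Γ)).induce {w | C.ψ w - C.ψ 1 ∈ box 2 ℓ}).Connected := by
  have hNℓ : C.N ≤ ℓ := le_trans (by unfold ℓ₀; omega) hℓ
  have h1 : (1 : Γ) ∈ {w | C.ψ w - C.ψ 1 ∈ box 2 ℓ} := by
    show C.ψ 1 - C.ψ 1 ∈ box 2 ℓ; rw [sub_self]; exact zero_mem_box 2 ℓ
  have key : ∀ x : {w | C.ψ w - C.ψ 1 ∈ box 2 ℓ},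
      ((mulCayley (S : Set Γ)).induce {w | C.ψ w - C.ψ 1 ∈ box 2 ℓ}).Reachable ⟨1, h1⟩ x := by
    rintro ⟨g, hgm⟩
    -- reduce coordinate 0, then coordinate 1
    obtain ⟨g₁, hg₁m, hg₁in, hg₁j, hr₁⟩ := C.reduce_coord 0 hNℓ _ g hgm le_rfl
    obtain ⟨g₂, hg₂m, hg₂in, hg₂j, hr₂⟩ := C.reduce_coord 1 hNℓ _ g₁ hg₁m le_rfl
    have hred : ∀ i : Fin 2, 0 ≤ C.ψ g₂ i ∧ C.ψ g₂ i < C.N := by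
      intro i
      fin_cases i
      · show 0 ≤ C.ψ g₂ 0 ∧ C.ψ g₂ 0 < C.N
        rw [hg₂j 0 (by decide)]; exact hg₁in
      · exact hg₂in
    exact (C.reachC_of_reduced hℓ hred h1 hg₂m).trans (hr₁.trans hr₂).symm
  exact (connected_iff _).2 ⟨fun a b => (key a).symm.trans (key b), ⟨⟨1, h1⟩⟩⟩

/-! ## §2 The scaled skeleton and the conditional theorem -/

/-- **THE ONE-TYPE SCALED SKELETON OF `Cay(Γ; S)` FOR AN ARBITRARY FINITE GENERATING SET**: chart `ψ`, Lipschitz constant `N`, base vertex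
`1`, frames = left translations, degree `≤ 2|S|`, exact `N`-steps along `t₀^{±1}, t₁^{±1}`, cylinders connected from width `ℓ₀` on.
[cite: KozmaNitzan2024, §4 p. 16 (Lemma 8)] [cite: BenjaminiSchramm1996, §2 (Cayley graphs)] -/
def skeletonFrmScaled : PlanarSkeletonFrmScaled (mulCayley (S : Set Γ)) where
  φ := C.ψ
  L := C.N
  lip := fun _ _ h i => C.lip_adj h i
  types := {1}
  frame := fun v => ⟨1, Finset.mem_singleton_self 1, leftMulIso S v, mul_one v, fun w => by
    show C.ψ (v * w) = C.ψ w + (C.ψ v - C.ψ 1)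
    rw [ψ_mul, ψ_one, sub_zero, add_comm]⟩
  Δ := 2 * S.card
  degree_le := degree_mulCayley_le S
  N := C.N
  one_le_N := C.one_le_N
  step := fun v i σ => by
    rcases Int.units_eq_one_or σ with rfl | rfl
    · exact ⟨v * C.gen' i, C.adj_gen' i v, by rw [ψ_mul_gen', Units.val_one, mul_one]⟩
    · refine ⟨v * (C.gen' i)⁻¹, C.adj_gen'_inv i v, ?_⟩
      rw [ψ_mul_gen'_inv, Units.val_neg, Units.val_one, mul_neg, mul_one, Pi.single_neg, sub_eq_add_neg]
  ℓ₀ := C.ℓ₀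
  cyl_connected := fun t ht ℓ hℓ => by
    rw [Finset.mem_singleton] at ht
    subst ht
    exact C.cyl_connected_of_le hℓ

/-- The skeleton has the single base type `1`. [folklore] -/
@[simp] theorem skeletonFrmScaled_types : C.skeletonFrmScaled.types = {1} := rfl

/-- The skeleton map is `ψ`. [folklore] -/
@[simp] theorem skeletonFrmScaled_φ : C.skeletonFrmScaled.φ = C.ψ := rfl

/-- The cylinders of the skeleton at the base vertex are the sets `{‖ψ‖_∞ ≤ ℓ}`. [folklore] -/
theorem skeletonFrmScaled_cyl (ℓ : ℕ) : C.skeletonFrmScaled.cyl 1 ℓ = {w | C.ψ w ∈ box 2 ℓ} := by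
  ext w
  show C.ψ w - C.ψ 1 ∈ box 2 ℓ ↔ C.ψ w ∈ box 2 ℓ
  rw [ψ_one, sub_zero]

include C in
/-- **CONDITIONAL THEOREM (arbitrary generating sets): `θ_g(p) = 0` on `Cay(Γ; S)` for every `p ≤ p_c` and every `CayleyScaled`** — INPUT =
(additive rank-2 chart, finitely generated kernel, `S` generating), NO range or step condition on `S`, NO automorphism — modulo the scaled one-type node
`SamePDropOfSkeletonFrmScaled₁` (OPEN; hypothesis `hN`) and Φ2 at `p_c` for the cylinders `{‖ψ‖_∞ ≤ ℓ}` (hypothesis `hC`; free for quasi-one-dimensional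
kernels, file `CayleyScaledCustomers`). [cite: BenjaminiSchramm1996, Conj. 4; §2] [cite: KozmaNitzan2024, §1 p. 2 (approach 1)] -/
theorem theta_eq_zero_of_le_of_frmScaledNode₁ (hN : SamePDropOfSkeletonFrmScaled₁)
    (hC : C.skeletonFrmScaled.CylSubcritical (criticalProbIOf (mulCayley (↑S : Set Γ)) (1 : Γ))) (g : Γ) {p : unitInterval}
    (hp : (p : ℝ) ≤ criticalProb (mulCayley (↑S : Set Γ)) g) : theta (mulCayley (↑S : Set Γ)) g p = 0 := by
  have hc : (mulCayley (S : Set Γ)).Connected :=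
    (connected_iff _).2 ⟨fun a b => (C.reachable_one a).symm.trans (C.reachable_one b), ⟨1⟩⟩
  haveI : Countable Γ := countable_of_connected_of_locallyFinite _ hc g
  have hpc0 : theta (mulCayley (S : Set Γ)) g (criticalProbIOf (mulCayley (S : Set Γ)) g) = 0 :=
    continuity_of_frmScaledNode₁' hN _ C.skeletonFrmScaled hc 1 (Finset.mem_singleton_self 1) rfl hC g
  have hmono : theta (mulCayley (S : Set Γ)) g p ≤ theta (mulCayley (S : Set Γ)) g (criticalProbIOf (mulCayley (S : Set Γ)) g) :=
    theta_mono_holds _ _ (Subtype.coe_le_coe.mp hp)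
  have hnn : 0 ≤ theta (mulCayley (S : Set Γ)) g p := MeasureTheory.measureReal_nonneg
  linarith

include C in
/-- **`θ_g(p_c) = 0` on `Cay(Γ; S)` (every vertex) for every `CayleyScaled`, modulo the scaled node and Φ2 at `p_c`.**
[cite: BenjaminiSchramm1996, Conj. 4; §2] -/
theorem criticalContinuity_of_frmScaledNode₁ (hN : SamePDropOfSkeletonFrmScaled₁)
    (hC : C.skeletonFrmScaled.CylSubcritical (criticalProbIOf (mulCayley (↑S : Set Γ)) (1 : Γ))) (g : Γ) :
    theta (mulCayley (↑S : Set Γ)) g (criticalProbIOf (mulCayley (↑S : Set Γ)) g) = 0 :=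
  C.theta_eq_zero_of_le_of_frmScaledNode₁ hN hC g le_rfl

end CayleyScaled

end Summit.CriticalPhenomena.PercolationContinuityZ3.Theorems.Transplant

end
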